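import Summits.MatrixMultiplication.MatrixMultiplication.Theorems.FarEdgeDescentLogRate

/-!
# Route `FarEdgeDescent` — ceiling of the first-power `CW_q` class, part 1: the three Gibbs certificates

decomp-mm ROOT cell (D-0178), lens 2 «structural dichotomy: special vs generic», gen 41 (Kernel XVI, file 1 of 2).

Elementary entropy inequalities for the CONVERSE of `FarEdgeDescentLogRateSharp` (the method ceiling of the full
first-power Coppersmith–Winograd certificate `FarEdgeDescentLogRate.cwFullFirstPowerValue`, proved in part 2
`FarEdgeDescentFirstPowerCeiling`).  Every step is one instance of Gibbs' inequality with mass defect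
(`shannon₃_gibbs`: `H(p) ≤ −Σ pᵢ log rᵢ + (Σ rᵢ − Σ pᵢ)` for any positive reference `r`, i.e. `log y ≤ y − 1`):

* `entropyRef_le_log` — the `q`-elimination `H(x,(1−x)/2,(1−x)/2) ≤ log(q+2) − x·log q`
  (reference `(q/(q+2), 1/(q+2), 1/(q+2))`; equality iff `q = 2x/(1−x)`),
  `log_two_le_entropyRef` — `H(x,(1−x)/2,(1−x)/2) ≥ log 2` for `x ≤ 1/3`;
* in the normalised variables `β > 0`, `σ, ρ ≥ 0`, `(k+2)β + 2σ + ρ = 1`, `x = (k+1+c')β` of the certificate: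
  `certX` (reference `((3/4)(1−x), x, (1/4)(1−x))` against the X-count entropy, slack
  `β(log 3 − (1+c') log 2) + σ(log 3 − 2 log 2) + ρ(log 3 − log 2) + c'β·log((1−x)/x)`),
  `certY` (`(x, (1−x)/2, (1−x)/2)` against the Y-count entropy, slack `(2σ − (1+c')β)·log(2x/(1−x))`),
  `certF` (`(2/3, 2⁻⁹, 1/3)` against the Y-count entropy: it is `< log 2` once `ρ ≤ σ`, `2β ≤ 2⁻⁹`).

NO definitions (gate rule D-0009).  Nothing here proves `ω = 2`.
-/

set_option linter.dupNamespace false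

noncomputable section

namespace Summit.MatrixMultiplication.MatrixMultiplication.Theorems.FarEdgeDescentFirstPowerCeilingCert

open Summit.MatrixMultiplication.MatrixMultiplication.Theorems.FarEdgeDescentLogRate (shannon₃)

/-! ## Gibbs' inequality for three cells, with mass defect -/

/-- Gibbs' inequality for three cells against an ARBITRARY positive reference vector, with the mass defect:
`H(p) ≤ −Σ pᵢ log rᵢ + (Σ rᵢ − Σ pᵢ)` (cell by cell `p log r − p log p ≤ r − p`, i.e. `log y ≤ y − 1` at `y = r/p`;
a cell with `p = 0` contributes `0 ≤ r`). -/
theorem shannon₃_gibbs {p₀ p₁ p₂ r₀ r₁ r₂ : ℝ} (hp₀ : 0 ≤ p₀) (hp₁ : 0 ≤ p₁) (hp₂ : 0 ≤ p₂)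
    (hr₀ : 0 < r₀) (hr₁ : 0 < r₁) (hr₂ : 0 < r₂) :
    shannon₃ p₀ p₁ p₂ ≤
      -(p₀ * Real.log r₀ + p₁ * Real.log r₁ + p₂ * Real.log r₂) + (r₀ + r₁ + r₂ - (p₀ + p₁ + p₂)) := by
  have cell : ∀ {p r : ℝ}, 0 ≤ p → 0 < r → p * Real.log r - p * Real.log p ≤ r - p := by
    intro p r hp hr
    rcases hp.eq_or_lt with h | h
    · subst h; simp [hr.le]
    · have h1 := Real.log_le_sub_one_of_pos (div_pos hr h)
      rw [Real.log_div hr.ne' h.ne'] at h1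
      have h2 := mul_le_mul_of_nonneg_left h1 hp
      have h3 : p * (r / p - 1) = r - p := by field_simp
      linarith [h2, h3]
  have h₀ := cell hp₀ hr₀
  have h₁ := cell hp₁ hr₁
  have h₂ := cell hp₂ hr₂
  unfold shannon₃
  linarith

/-! ## Step (1): `q`-elimination by concavity of `log` -/

/-- `H(x, (1−x)/2, (1−x)/2) ≤ log(q+2) − x·log q` for `0 < x < 1`, `q > 0` (Gibbs against the probability
vector `(q/(q+2), 1/(q+2), 1/(q+2))`; equality iff `q = 2x/(1−x)`). -/
theorem entropyRef_le_log {x q : ℝ} (hx : 0 < x) (hx1 : x < 1) (hq : 0 < q) :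
    shannon₃ x ((1 - x) / 2) ((1 - x) / 2) ≤ Real.log (q + 2) - x * Real.log q := by
  have hq2 : 0 < q + 2 := by linarith
  have h1x : 0 < 1 - x := by linarith
  have G := shannon₃_gibbs (p₀ := x) (p₁ := (1 - x) / 2) (p₂ := (1 - x) / 2) (r₀ := q / (q + 2))
    (r₁ := 1 / (q + 2)) (r₂ := 1 / (q + 2)) hx.le (by positivity) (by positivity) (div_pos hq hq2)
    (by positivity) (by positivity)
  rw [Real.log_div hq.ne' hq2.ne', Real.log_div one_ne_zero hq2.ne', Real.log_one, zero_sub] at G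
  have e : q / (q + 2) + 1 / (q + 2) + 1 / (q + 2) = 1 := by
    rw [show q / (q + 2) + 1 / (q + 2) + 1 / (q + 2) = (q + 2) / (q + 2) by ring, div_self hq2.ne']
  linarith

/-- `H(x, (1−x)/2, (1−x)/2) ≥ log 2` for `0 < x ≤ 1/3`. -/
theorem log_two_le_entropyRef {x : ℝ} (hx : 0 < x) (hx3 : x ≤ 1 / 3) :
    Real.log 2 ≤ shannon₃ x ((1 - x) / 2) ((1 - x) / 2) := by
  have h1x : 0 < 1 - x := by linarith
  have hlx : Real.log x ≤ -Real.log 3 := by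
    have h := Real.log_le_log hx hx3
    rwa [one_div, Real.log_inv] at h
  have hl1x : Real.log (1 - x) ≤ 0 := Real.log_nonpos (by linarith) (by linarith)
  have h23 : Real.log 2 ≤ Real.log 3 := Real.log_le_log two_pos (by norm_num)
  have a := mul_le_mul_of_nonneg_left hlx hx.le
  have b := mul_le_mul_of_nonneg_left hl1x h1x.le
  have d := mul_le_mul_of_nonneg_left h23 hx.le
  unfold shannon₃
  rw [Real.log_div h1x.ne' two_ne_zero]
  nlinarith [a, b, d]

/-! ## Step (2): the three Gibbs certificates

Normalised variables: `β > 0`, `σ, ρ ≥ 0` with `(k+2)β + 2σ + ρ = 1` (so `β = (1−2σ−ρ)/(k+2)` in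
`cwFullFirstPowerValue`), `0 ≤ c' < 1`, `x = (k+1+c')β`; the X-count entropy is `shannon₃ (β+ρ+σ) (kβ+β) σ`, the
Y-count entropy is `shannon₃ (kβ+2σ) (2β) ρ`, the reference entropy is `shannon₃ x ((1−x)/2) ((1−x)/2)`. -/

/-- `certX`: the X-count entropy against `r^X = ((3/4)(1−x), x, (1/4)(1−x))`.  The slack
`β(log 3 − (1+c') log 2) + σ(log 3 − 2 log 2) + ρ(log 3 − log 2) + c'β·log((1−x)/x)` equals
`β·(c₁ − (σ/β − 1/2)·log(4/3) + (ρ/β)·log(3/2) − c'·log(2x/(1−x)))`, `c₁ = (3/2) log 3 − 2 log 2`. -/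
theorem certX {k β σ ρ c' x : ℝ} (hk : 0 ≤ k) (hβ : 0 < β) (hσ : 0 ≤ σ) (hρ : 0 ≤ ρ) (hc' : 0 ≤ c')
    (hc'1 : c' < 1) (hsum : (k + 2) * β + 2 * σ + ρ = 1) (hx : x = (k + 1 + c') * β) :
    shannon₃ (β + ρ + σ) (k * β + β) σ +
        (β * (Real.log 3 - (1 + c') * Real.log 2) + σ * (Real.log 3 - 2 * Real.log 2) +
          ρ * (Real.log 3 - Real.log 2) + c' * β * (Real.log (1 - x) - Real.log x)) ≤
      shannon₃ x ((1 - x) / 2) ((1 - x) / 2) := by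
  have hx0 : 0 < x := by rw [hx]; positivity
  have hxe : x = 1 - 2 * σ - ρ - (1 - c') * β := by rw [hx]; linarith
  have h1c : 0 < (1 - c') * β := mul_pos (by linarith) hβ
  have h1x : 0 < 1 - x := by rw [hxe]; linarith
  have G := shannon₃_gibbs (p₀ := β + ρ + σ) (p₁ := k * β + β) (p₂ := σ) (r₀ := 3 / 4 * (1 - x))
    (r₁ := x) (r₂ := 1 / 4 * (1 - x)) (by positivity) (by positivity) hσ (by positivity) hx0
    (by positivity)
  have l1 : Real.log (3 / 4 * (1 - x)) = Real.log 3 - 2 * Real.log 2 + Real.log (1 - x) := by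
    rw [Real.log_mul (by norm_num) h1x.ne', Real.log_div (by norm_num) (by norm_num),
      show (4 : ℝ) = 2 ^ 2 by norm_num, Real.log_pow]
    push_cast; ring
  have l2 : Real.log (1 / 4 * (1 - x)) = -(2 * Real.log 2) + Real.log (1 - x) := by
    rw [Real.log_mul (by norm_num) h1x.ne', Real.log_div one_ne_zero (by norm_num), Real.log_one,
      show (4 : ℝ) = 2 ^ 2 by norm_num, Real.log_pow]
    push_cast; ring
  have l3 : Real.log ((1 - x) / 2) = Real.log (1 - x) - Real.log 2 := Real.log_div h1x.ne' two_ne_zero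
  rw [l1, l2] at G
  have m1 : Real.log 2 = ((k + 2) * β + 2 * σ + ρ) * Real.log 2 := by rw [hsum, one_mul]
  have m2 : Real.log (1 - x) = ((k + 2) * β + 2 * σ + ρ) * Real.log (1 - x) := by rw [hsum, one_mul]
  unfold shannon₃ at G ⊢
  rw [l3]
  subst hx
  linarith

/-- `certY`: the Y-count entropy against `r^Y = (x, (1−x)/2, (1−x)/2)`; slack `(2σ − (1+c')β)·log(2x/(1−x))`. -/
theorem certY {k β σ ρ c' x : ℝ} (hk : 0 ≤ k) (hβ : 0 < β) (hσ : 0 ≤ σ) (hρ : 0 ≤ ρ) (hc' : 0 ≤ c')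
    (hc'1 : c' < 1) (hsum : (k + 2) * β + 2 * σ + ρ = 1) (hx : x = (k + 1 + c') * β) :
    shannon₃ (k * β + 2 * σ) (2 * β) ρ + (2 * σ - (1 + c') * β) * (Real.log (2 * x) - Real.log (1 - x)) ≤
      shannon₃ x ((1 - x) / 2) ((1 - x) / 2) := by
  have hx0 : 0 < x := by rw [hx]; positivity
  have hxe : x = 1 - 2 * σ - ρ - (1 - c') * β := by rw [hx]; linarith
  have h1c : 0 < (1 - c') * β := mul_pos (by linarith) hβ
  have h1x : 0 < 1 - x := by rw [hxe]; linarith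
  have G := shannon₃_gibbs (p₀ := k * β + 2 * σ) (p₁ := 2 * β) (p₂ := ρ) (r₀ := x)
    (r₁ := (1 - x) / 2) (r₂ := (1 - x) / 2) (by positivity) (by positivity) hρ hx0 (by positivity)
    (by positivity)
  have l3 : Real.log ((1 - x) / 2) = Real.log (1 - x) - Real.log 2 := Real.log_div h1x.ne' two_ne_zero
  have l4 : Real.log (2 * x) = Real.log 2 + Real.log x := Real.log_mul two_ne_zero hx0.ne'
  rw [l3] at G
  have m1 : Real.log 2 = ((k + 2) * β + 2 * σ + ρ) * Real.log 2 := by rw [hsum, one_mul]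
  have m2 : Real.log (1 - x) = ((k + 2) * β + 2 * σ + ρ) * Real.log (1 - x) := by rw [hsum, one_mul]
  unfold shannon₃ at G ⊢
  rw [l3, l4]
  subst hx
  linarith

/-- `certF` (far region): the Y-count entropy against the reference `(2/3, 2⁻⁹, 1/3)` is `< log 2` once `ρ ≤ σ`
and `2β ≤ 2⁻⁹`:  `H_Y ≤ (1−2β−ρ) log(3/2) + 18β·log 2 + ρ·log 3 + 2⁻⁹ ≤ (1−2β)(log 3 − (2/3) log 2) + 18β·log 2
+ 2⁻⁹ < log 2` (`ρ ≤ (1−2β)/3`, `log(3/4) ≤ −1/4`). -/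
theorem certF {k β σ ρ : ℝ} (hk : 0 ≤ k) (hβ : 0 < β) (hρ : 0 ≤ ρ)
    (hsum : (k + 2) * β + 2 * σ + ρ = 1) (hρσ : ρ ≤ σ) (hβs : 2 * β ≤ 1 / 512) :
    shannon₃ (k * β + 2 * σ) (2 * β) ρ < Real.log 2 := by
  have hkβ : 0 ≤ k * β := mul_nonneg hk hβ.le
  have hp0 : k * β + 2 * σ = 1 - 2 * β - ρ := by linarith
  rw [hp0]
  have hP : 0 ≤ 1 - 2 * β - ρ := by linarith
  have hρ3 : ρ ≤ (1 - 2 * β) / 3 := by linarith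
  have G := shannon₃_gibbs (p₀ := 1 - 2 * β - ρ) (p₁ := 2 * β) (p₂ := ρ) (r₀ := 2 / 3) (r₁ := 1 / 512)
    (r₂ := 1 / 3) hP (by positivity) hρ (by norm_num) (by norm_num) (by norm_num)
  have la : Real.log (2 / 3 : ℝ) = Real.log 2 - Real.log 3 := Real.log_div two_ne_zero (by norm_num)
  have lb : Real.log (1 / 3 : ℝ) = -Real.log 3 := by
    rw [Real.log_div one_ne_zero (by norm_num), Real.log_one, zero_sub]
  have l512 : Real.log (1 / 512 : ℝ) = -(9 * Real.log 2) := by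
    rw [Real.log_div one_ne_zero (by norm_num), Real.log_one, show (512 : ℝ) = 2 ^ 9 by norm_num,
      Real.log_pow]
    push_cast; ring
  rw [la, lb, l512] at G
  have hl2 := Real.log_two_lt_d9
  have hl2p : 0 < Real.log 2 := Real.log_pos (by norm_num)
  -- `log 3 ≤ 2 log 2 − 1/4`, from `log (3/4) ≤ 3/4 − 1`
  have hl3 : Real.log 3 ≤ 2 * Real.log 2 - 1 / 4 := by
    have h := Real.log_le_sub_one_of_pos (by norm_num : (0 : ℝ) < 3 / 4)
    rw [Real.log_div (by norm_num) (by norm_num), show (4 : ℝ) = 2 ^ 2 by norm_num, Real.log_pow] at h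
    push_cast at h
    linarith
  have hl23 : Real.log 2 ≤ Real.log 3 := Real.log_le_log two_pos (by norm_num)
  have f1 : ρ * Real.log 2 ≤ (1 - 2 * β) / 3 * Real.log 2 := mul_le_mul_of_nonneg_right hρ3 hl2p.le
  have f2 : β * Real.log 2 ≤ 1 / 1024 * Real.log 2 := mul_le_mul_of_nonneg_right (by linarith) hl2p.le
  have f3 : 0 ≤ β * Real.log 3 := mul_nonneg hβ.le (hl2p.le.trans hl23)
  linarith

end Summit.MatrixMultiplication.MatrixMultiplication.Theorems.FarEdgeDescentFirstPowerCeilingCert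

end
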